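import Mathlib.NumberTheory.Padics.RingHoms
import Mathlib.NumberTheory.Padics.ProperSpace
import Mathlib.Topology.Algebra.Module.Basic
import Mathlib.LinearAlgebra.Dimension.Constructions
import Mathlib.LinearAlgebra.Dimension.Finrank
import Mathlib.LinearAlgebra.FreeModule.PID
import Literature.NumberTheory.GaloisRepresentations.LocalGlobalCohomologyFiniteProofs
import HarnessLib

/-!
# Homomorphisms `K^× → ℤ_lⁿ` with dense image have `n ≤ 1` (`l ≠ p`), `n ≤ [K:ℚ_p] + 1` (`l = p`)

Proof-only file (no definitions, no named facts).  `K` is a non-archimedean local field (Mathlib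
`IsNonarchimedeanLocalField`, valued model) of residue characteristic `p` in the sense that its
unit group `𝒪_K^×` has a subgroup `W` of finite index abstractly isomorphic to `ℤ_p^d` (for a
finite extension of `ℚ_p` the higher one-units `U₂ = 1 + p²𝒪_K ≃ ℤ_p^{[K:ℚ_p]}` qualify:
`MLFIntegerLatticeProofs.exists_oneUnits_continuousMulEquiv`).  We PROVE the upper bounds in the
rank formula of S. Mochizuki, *Topics in Absolute Anabelian Geometry I* (2012) [AbsTopI] Thm 2.6
(ii) p. 21 — "`δ¹_l(G) = 1` if `l ≠ p`, `δ¹_p(G) = [k : ℚ_p] + 1`" — transported to `K^×` by local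
class field theory `G_K^{ab} ≅ (K^×)^∧` ([AbsAnab] §1.2 p. 9) and
`FreeProlRankCompletionProofs.freeProlRank_profiniteCompletion` (`δ¹_l((K^×)^∧) = sup {n : ∃`
homomorphism `K^× → ℤ_lⁿ` with dense image`}`):

* `le_succ_of_denseRange_of_units` — if `W ≃ ℤ_p^d` then every homomorphism
  `f : K^× → ℤ_pⁿ` with dense image has `n ≤ d + 1`;
* `le_one_of_denseRange_of_units` — for a prime `l ≠ p`, every homomorphism `f : K^× → ℤ_lⁿ`
  with dense image has `n ≤ 1`.

Mechanism (`K^× = ϖ^ℤ · 𝒪_K^×`, tree `exists_eq_units_mul_zpow`; `m = [𝒪_K^× : W]`): `m · f(K^×)`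
lies in the `ℤ_l`-span `L` of `f(ϖ)` and of the image of `W`; additive maps `ℤ_p^d → ℤ_pⁿ` are
automatically `ℤ_p`-linear (`addMonoidHom_map_smul_padicInt`: approximate `a ∈ ℤ_p` by integers
modulo `p^k`), so for `l = p` that image is spanned by `d` vectors, while for `l ≠ p` it vanishes
(`addMonoidHom_padicInt_module_eq_zero`: `ℤ_p^d` is `l`-divisible and `⋂ l^k ℤ_lⁿ = 0`); `L` is
closed (continuous image of the compact `ℤ_l^{k+1}`), so by density `m · ℤ_lⁿ ⊆ L` and
`n = rank (m ℤ_lⁿ) ≤ rank L ≤ k + 1`.  This is the content of "`K^× ≅ ℤ × μ × ℤ_p^{[K:ℚ_p]}`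
⇒ ranks of `G_K^{ab}` over `ℤ_l`" in [AbsAnab] Lemma 1.1.4 (ii) / Prop 1.2.1 (i) proofs.

HONEST FRAMING: classical and undisputed (Neukirch II (5.7), Serre XIV §4); nothing here bears
on [IUTchIII] Cor. 3.12.
-/

noncomputable section

open ValuativeRel Topology Filter

namespace Literature.AnabelianGeometry.AbsoluteAnabelian

open Literature.NumberTheory.GaloisRepresentations

/-! ### Additive maps into `ℤ_lⁿ` out of `ℤ_p`-modules -/

section PadicLinear

variable {p : ℕ} [Fact p.Prime]

/-- **Automatic `ℤ_p`-linearity.**  Every additive map from a `ℤ_p`-module to `ℤ_pⁿ` is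
`ℤ_p`-linear: write `a = a_k + p^k b` with `a_k ∈ ℕ` (`PadicInt.appr`); then
`h(a v) − a h(v) = p^k (h(b v) − b h(v))` has coordinates of norm `≤ p^{-k}` for every `k`.  (The
mechanism behind "ranks of `G^{ab}` over `ℤ_p`", [AbsAnab] Lemma 1.1.4 (ii) proof p. 8.)
[cite: MochizukiAbsAnab2004, Lemma 1.1.4 (ii) proof p.8] -/
theorem addMonoidHom_map_smul_padicInt {M : Type*} [AddCommGroup M] [Module ℤ_[p] M] {n : ℕ}
    (h : M →+ (Fin n → ℤ_[p])) (a : ℤ_[p]) (v : M) : h (a • v) = a • h v := by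
  have hp : p.Prime := Fact.out
  suffices hD : ∀ (k : ℕ) (i : Fin n), ‖(h (a • v) - a • h v) i‖ ≤ (p : ℝ) ^ (-k : ℤ) by
    have hzero : h (a • v) - a • h v = 0 := by
      funext i
      by_contra hne
      have hpos : 0 < ‖(h (a • v) - a • h v) i‖ := norm_pos_iff.mpr hne
      obtain ⟨k, hk⟩ := PadicInt.exists_pow_neg_lt p hpos
      exact absurd ((hD k i).trans_lt hk) (lt_irrefl _)
    exact sub_eq_zero.mp hzero
  intro k i
  -- `a = a₀ + p^k b` with `a₀ ∈ ℕ`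
  obtain ⟨a₀, b, ha⟩ : ∃ (a₀ : ℕ) (b : ℤ_[p]), a = (a₀ : ℤ_[p]) + ((p ^ k : ℕ) : ℤ_[p]) * b := by
    have hmem := PadicInt.appr_spec k a
    rw [Ideal.mem_span_singleton'] at hmem
    obtain ⟨b, hb⟩ := hmem
    refine ⟨PadicInt.appr a k, b, ?_⟩
    rw [Nat.cast_pow, mul_comm, hb]
    ring
  subst ha
  -- expand both sides
  have h1 : h (((a₀ : ℤ_[p]) + ((p ^ k : ℕ) : ℤ_[p]) * b) • v) =
      a₀ • h v + (p ^ k : ℕ) • h (b • v) := by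
    rw [add_smul, map_add, mul_smul, Nat.cast_smul_eq_nsmul, Nat.cast_smul_eq_nsmul,
      map_nsmul, map_nsmul]
  have h2 : ((a₀ : ℤ_[p]) + ((p ^ k : ℕ) : ℤ_[p]) * b) • h v =
      a₀ • h v + (p ^ k : ℕ) • (b • h v) := by
    rw [add_smul, mul_smul, Nat.cast_smul_eq_nsmul, Nat.cast_smul_eq_nsmul]
  have hdiff : h (((a₀ : ℤ_[p]) + ((p ^ k : ℕ) : ℤ_[p]) * b) • v) -
      ((a₀ : ℤ_[p]) + ((p ^ k : ℕ) : ℤ_[p]) * b) • h v =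
      ((p : ℤ_[p]) ^ k) • (h (b • v) - b • h v) := by
    rw [h1, h2, add_sub_add_left_eq_sub, ← smul_sub, ← Nat.cast_smul_eq_nsmul ℤ_[p], Nat.cast_pow]
  rw [hdiff, Pi.smul_apply, smul_eq_mul, norm_mul, PadicInt.norm_p_pow]
  exact mul_le_of_le_one_right (zpow_nonneg (by exact_mod_cast hp.pos.le) _)
    (PadicInt.norm_le_one _)

/-- **Additive maps from a `ℤ_p`-module to `ℤ_lⁿ`, `l ≠ p`, vanish**: `ℤ_p`-modules are
`l`-divisible (`l ∈ ℤ_pˣ`), so the image of `v` lies in `l^k ℤ_lⁿ` for every `k` — why the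
pro-`p` part of `G_k^{ab}` contributes nothing to `δ¹_l`, `l ≠ p` ([AbsTopI] Thm 2.6 (ii)
"`δ¹_l(G) = 1` if `l ≠ p`"). [cite: MochizukiAbsTopI2012, Thm 2.6 (ii) p.21] -/
theorem addMonoidHom_padicInt_module_eq_zero {M : Type*} [AddCommGroup M] [Module ℤ_[p] M]
    {l : ℕ} [Fact l.Prime] (hl : l ≠ p) {n : ℕ} (h : M →+ (Fin n → ℤ_[l])) : h = 0 := by
  have hp : p.Prime := Fact.out
  have hlp : l.Prime := Fact.out
  -- `l` is a unit of `ℤ_p`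
  have hu : IsUnit (l : ℤ_[p]) := by
    rw [PadicInt.isUnit_iff]
    have h1 : ‖((l : ℤ) : ℤ_[p])‖ = 1 := by
      apply le_antisymm (PadicInt.norm_le_one _)
      by_contra hlt
      have hlt' : ‖((l : ℤ) : ℤ_[p])‖ < 1 := lt_of_not_ge hlt
      rw [PadicInt.norm_int_lt_one_iff_dvd] at hlt'
      have hdvd : p ∣ l := by exact_mod_cast hlt'
      exact hl ((Nat.prime_dvd_prime_iff_eq hp hlp).mp hdvd).symm
    simpa using h1
  obtain ⟨u, hu'⟩ := hu
  ext v i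
  change h v i = 0
  -- `h v = l^k • h (u⁻ᵏ • v)` for every `k`
  have hk : ∀ k : ℕ, h v = (l ^ k : ℕ) • h ((((u⁻¹ : ℤ_[p]ˣ) : ℤ_[p]) ^ k) • v) := by
    intro k
    rw [← map_nsmul, ← Nat.cast_smul_eq_nsmul ℤ_[p], smul_smul]
    congr 1
    rw [Nat.cast_pow, ← hu', ← mul_pow, Units.mul_inv, one_pow, one_smul]
  by_contra hne
  have hpos : 0 < ‖h v i‖ := norm_pos_iff.mpr hne
  obtain ⟨k, hk'⟩ := PadicInt.exists_pow_neg_lt l hpos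
  have hle : ‖h v i‖ ≤ (l : ℝ) ^ (-k : ℤ) := by
    rw [hk k, Pi.smul_apply, ← Nat.cast_smul_eq_nsmul ℤ_[l], smul_eq_mul, norm_mul, Nat.cast_pow,
      PadicInt.norm_p_pow]
    exact mul_le_of_le_one_right (zpow_nonneg (by exact_mod_cast hlp.pos.le) _)
      (PadicInt.norm_le_one _)
  exact absurd (hle.trans_lt hk') (lt_irrefl _)

/-- The `ℤ_l`-span of finitely many vectors of `ℤ_lⁿ` is closed (it is the continuous image of
the compact `ℤ_l^k`). [folklore] -/
private theorem isClosed_span_range_padicInt {l : ℕ} [Fact l.Prime] {n k : ℕ}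
    (g : Fin k → (Fin n → ℤ_[l])) :
    IsClosed ((Submodule.span ℤ_[l] (Set.range g) : Submodule ℤ_[l] (Fin n → ℤ_[l])) :
      Set (Fin n → ℤ_[l])) := by
  rw [← Fintype.range_linearCombination, LinearMap.coe_range]
  have hc : Continuous (Fintype.linearCombination ℤ_[l] g) :=
    LinearMap.continuous_on_pi (Fintype.linearCombination ℤ_[l] g)
  exact (isCompact_range hc).isClosed

/-- If `m ≠ 0` and `m · ℤ_lⁿ ⊆ L` for a submodule `L ≤ ℤ_lⁿ`, then `n ≤ rank L` (finite-index
sublattices have full rank; the rank bookkeeping of [AbsAnab] Lemma 1.1.4 (ii) proof p. 8).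
[cite: MochizukiAbsAnab2004, Lemma 1.1.4 (ii) proof p.8] -/
theorem le_finrank_of_smul_le {l : ℕ} [Fact l.Prime] {n : ℕ} {m : ℕ} (hm : m ≠ 0)
    (L : Submodule ℤ_[l] (Fin n → ℤ_[l])) (hL : ∀ a : Fin n → ℤ_[l], (m : ℤ_[l]) • a ∈ L) :
    n ≤ Module.finrank ℤ_[l] L := by
  let μ : (Fin n → ℤ_[l]) →ₗ[ℤ_[l]] (Fin n → ℤ_[l]) := (m : ℤ_[l]) • LinearMap.id
  have hμ : Function.Injective μ := by
    have hm' : (m : ℤ_[l]) ≠ 0 := by exact_mod_cast hm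
    intro x y hxy
    exact smul_right_injective (Fin n → ℤ_[l]) hm' hxy
  have hrange : LinearMap.range μ ≤ L := by
    rintro _ ⟨a, rfl⟩
    exact hL a
  haveI : Module.Finite ℤ_[l] L := Module.Finite.iff_fg.mpr (IsNoetherian.noetherian L)
  have h1 : Module.finrank ℤ_[l] (LinearMap.range μ) = n := by
    rw [LinearMap.finrank_range_of_inj hμ, Module.finrank_fin_fun]
  have h2 := LinearMap.finrank_le_finrank_of_injective (Submodule.inclusion_injective hrange)
  rwa [h1] at h2

end PadicLinear

/-! ### The rank bounds for `K^×` -/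

section RankBound

variable (K : Type*) [Field K] [ValuativeRel K] [TopologicalSpace K] [IsNonarchimedeanLocalField K]

/-- Core of both bounds.  Let `f : K^× → ℤ_lⁿ` be a homomorphism with dense image, `W ≤ 𝒪_K^×`
a subgroup of finite index, and `g₁, …, g_k ∈ ℤ_lⁿ` vectors whose `ℤ_l`-span contains the
image of `W`.  Then `n ≤ k + 1`: writing `K^× = ϖ^ℤ · 𝒪_K^×` (tree
`exists_eq_units_mul_zpow`) and `m = [𝒪_K^× : W]`, `m · f(K^×)` lies in the closed span `L` of
`f(ϖ), g₁, …, g_k`, hence so does `m · ℤ_lⁿ` by density, and `n ≤ rank L ≤ k + 1`.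
[cite: MochizukiAbsTopI2012, Thm 2.6 (ii) p.21] -/
theorem le_succ_of_denseRange_of_span {l : ℕ} [Fact l.Prime] {n k : ℕ}
    (f : Kˣ →* Multiplicative (Fin n → ℤ_[l])) (hf : DenseRange f)
    (W : Subgroup (𝒪[K])ˣ) [W.FiniteIndex] (g : Fin k → (Fin n → ℤ_[l]))
    (hW : ∀ w ∈ W, Multiplicative.toAdd (f (Units.map (𝒪[K].subtype : 𝒪[K] →* K) w)) ∈
      Submodule.span ℤ_[l] (Set.range g)) :
    n ≤ k + 1 := by
  classical
  letI : UniformSpace K := IsTopologicalAddGroup.rightUniformSpace K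
  haveI : IsUniformAddGroup K := isUniformAddGroup_of_addCommGroup
  set ι : (𝒪[K])ˣ →* Kˣ := Units.map (𝒪[K].subtype : 𝒪[K] →* K) with hι
  obtain ⟨π, hπ⟩ := IsDiscreteValuationRing.exists_irreducible 𝒪[K]
  have hπ0 : (π : K) ≠ 0 := fun h => hπ.ne_zero (Subtype.ext h)
  let πu : Kˣ := Units.mk0 (π : K) hπ0
  set F : Kˣ → (Fin n → ℤ_[l]) := fun x => Multiplicative.toAdd (f x) with hF
  have hFmul : ∀ x y : Kˣ, F (x * y) = F x + F y := fun x y => by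
    simp [hF, map_mul, toAdd_mul]
  have hFpow : ∀ (x : Kˣ) (j : ℕ), F (x ^ j) = j • F x := fun x j => by
    simp [hF, map_pow, toAdd_pow]
  have hFzpow : ∀ (x : Kˣ) (j : ℤ), F (x ^ j) = j • F x := fun x j => by
    simp [hF, map_zpow, toAdd_zpow]
  set c : Fin n → ℤ_[l] := F πu with hc
  -- the closed lattice `L = ℤ_l c + ∑ ℤ_l gᵢ`
  let G : Fin (k + 1) → (Fin n → ℤ_[l]) := Fin.cons c g
  let L : Submodule ℤ_[l] (Fin n → ℤ_[l]) := Submodule.span ℤ_[l] (Set.range G)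
  have hLclosed : IsClosed (L : Set (Fin n → ℤ_[l])) := isClosed_span_range_padicInt G
  have hcL : c ∈ L := Submodule.subset_span ⟨0, by simp [G]⟩
  have hgL : Submodule.span ℤ_[l] (Set.range g) ≤ L := by
    refine Submodule.span_le.mpr ?_
    rintro _ ⟨j, rfl⟩
    exact Submodule.subset_span ⟨j.succ, by simp [G]⟩
  -- `m = [𝒪ˣ : W]`
  set m : ℕ := W.index with hm_def
  have hm0 : m ≠ 0 := Subgroup.FiniteIndex.index_ne_zero
  -- `m · F(x) ∈ L` for every `x ∈ K^×`
  have hmem : ∀ x : Kˣ, (m : ℤ_[l]) • F x ∈ L := by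
    intro x
    obtain ⟨j, u, hx⟩ := exists_eq_units_mul_zpow K hπ x
    have hx' : x = ι u * πu ^ j := by
      ext
      rw [Units.val_mul, Units.val_zpow_eq_zpow_val]
      exact hx
    have hum : u ^ m ∈ W := Subgroup.pow_index_mem W u
    have h1 : (m : ℤ_[l]) • F (ι u) ∈ L := by
      rw [Nat.cast_smul_eq_nsmul, ← hFpow, ← map_pow]
      exact hgL (hW (u ^ m) hum)
    have h2 : (m : ℤ_[l]) • F (πu ^ j) ∈ L := by
      rw [hFzpow]
      exact Submodule.smul_mem _ _ (zsmul_mem hcL j)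
    rw [hx', hFmul, smul_add]
    exact L.add_mem h1 h2
  -- by density, `m · ℤ_lⁿ ⊆ L`
  have hdense : DenseRange F :=
    Multiplicative.toAdd.surjective.denseRange.comp hf continuous_toAdd
  have hall : ∀ a : Fin n → ℤ_[l], (m : ℤ_[l]) • a ∈ L := by
    have hS : IsClosed {a : Fin n → ℤ_[l] | (m : ℤ_[l]) • a ∈ L} :=
      hLclosed.preimage (continuous_const_smul (m : ℤ_[l]))
    have hsub : Set.range F ⊆ {a : Fin n → ℤ_[l] | (m : ℤ_[l]) • a ∈ L} := by
      rintro _ ⟨x, rfl⟩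
      exact hmem x
    have huniv : {a : Fin n → ℤ_[l] | (m : ℤ_[l]) • a ∈ L} = Set.univ := by
      apply Set.eq_univ_of_univ_subset
      rw [← hdense.closure_range]
      exact closure_minimal hsub hS
    intro a
    have : a ∈ {a : Fin n → ℤ_[l] | (m : ℤ_[l]) • a ∈ L} := by rw [huniv]; trivial
    exact this
  -- ranks
  have h1 : n ≤ Module.finrank ℤ_[l] L := le_finrank_of_smul_le hm0 L hall
  have h2 : Module.finrank ℤ_[l] L ≤ k + 1 := by
    have := finrank_range_le_card (R := ℤ_[l]) G
    rw [Fintype.card_fin] at this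
    exact this
  exact h1.trans h2

/-- **`l = p`: `n ≤ d + 1`.**  If `𝒪_K^×` has a subgroup `W` of finite index with `W ≃ ℤ_p^d`
(abstractly), then every homomorphism `f : K^× → ℤ_pⁿ` with dense image has `n ≤ d + 1` — the
upper bound in [AbsTopI] Thm 2.6 (ii)'s "`δ¹_p(G_k) = [k : ℚ_p] + 1`" on the `K^×` side
(`K^× ≅ ℤ × 𝒪_K^×`, `𝒪_K^× ⊇ U ≅ ℤ_p^{[k:ℚ_p]}` of finite index).  The image of `W` is the image
of an additive, hence `ℤ_p`-linear (`addMonoidHom_map_smul_padicInt`), map `ℤ_p^d → ℤ_pⁿ`, so it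
is spanned by `d` vectors. [cite: MochizukiAbsTopI2012, Thm 2.6 (ii) p.21] -/
theorem le_succ_of_denseRange_of_units {p : ℕ} [Fact p.Prime] {n d : ℕ}
    (W : Subgroup (𝒪[K])ˣ) [W.FiniteIndex] (eW : W ≃* Multiplicative (Fin d → ℤ_[p]))
    (f : Kˣ →* Multiplicative (Fin n → ℤ_[p])) (hf : DenseRange f) :
    n ≤ d + 1 := by
  classical
  set ι : (𝒪[K])ˣ →* Kˣ := Units.map (𝒪[K].subtype : 𝒪[K] →* K) with hι
  -- the additive map `ℤ_p^d → ℤ_pⁿ` induced on `W`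
  let h : (Fin d → ℤ_[p]) →+ (Fin n → ℤ_[p]) :=
    { toFun := fun v => Multiplicative.toAdd (f (ι (W.subtype (eW.symm (Multiplicative.ofAdd v)))))
      map_zero' := by simp
      map_add' := fun v w => by
        simp only [ofAdd_add, map_mul, toAdd_mul] }
  let hL : (Fin d → ℤ_[p]) →ₗ[ℤ_[p]] (Fin n → ℤ_[p]) :=
    { toFun := h
      map_add' := h.map_add
      map_smul' := fun a v => addMonoidHom_map_smul_padicInt h a v }
  let g : Fin d → (Fin n → ℤ_[p]) := fun j => hL (Pi.single j 1)
  refine le_succ_of_denseRange_of_span K f hf W g ?_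
  intro w hw
  have hrepr : Multiplicative.toAdd (f (ι w)) =
      hL (Multiplicative.toAdd (eW ⟨w, hw⟩)) := by
    change _ = Multiplicative.toAdd (f (ι (W.subtype (eW.symm (Multiplicative.ofAdd
      (Multiplicative.toAdd (eW ⟨w, hw⟩)))))))
    rw [ofAdd_toAdd, MulEquiv.symm_apply_apply]
    rfl
  rw [hrepr]
  set v : Fin d → ℤ_[p] := Multiplicative.toAdd (eW ⟨w, hw⟩) with hv
  have hsum : v = ∑ j, v j • (Pi.single j (1 : ℤ_[p]) : Fin d → ℤ_[p]) := by
    conv_lhs => rw [← Finset.univ_sum_single v]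
    refine Finset.sum_congr rfl fun j _ => ?_
    ext i
    simp [Pi.single_apply]
  rw [hsum, map_sum]
  refine Submodule.sum_mem _ fun j _ => ?_
  rw [map_smul]
  exact Submodule.smul_mem _ _ (Submodule.subset_span ⟨j, rfl⟩)

/-- **`l ≠ p`: `n ≤ 1`.**  If `𝒪_K^×` has a subgroup `W` of finite index with `W ≃ ℤ_p^d`
(abstractly), then for every prime `l ≠ p` every homomorphism `f : K^× → ℤ_lⁿ` with dense image
has `n ≤ 1` — the upper bound in [AbsTopI] Thm 2.6 (ii)'s "`δ¹_l(G_k) = 1` if `l ≠ p`" on the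
`K^×` side: the image of `W ≃ ℤ_p^d` vanishes (`addMonoidHom_padicInt_module_eq_zero`), so only
`f(ϖ)` survives. [cite: MochizukiAbsTopI2012, Thm 2.6 (ii) p.21] -/
theorem le_one_of_denseRange_of_units {p : ℕ} [Fact p.Prime] {l : ℕ} [Fact l.Prime] (hl : l ≠ p)
    {n d : ℕ} (W : Subgroup (𝒪[K])ˣ) [W.FiniteIndex] (eW : W ≃* Multiplicative (Fin d → ℤ_[p]))
    (f : Kˣ →* Multiplicative (Fin n → ℤ_[l])) (hf : DenseRange f) :
    n ≤ 1 := by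
  classical
  set ι : (𝒪[K])ˣ →* Kˣ := Units.map (𝒪[K].subtype : 𝒪[K] →* K) with hι
  let h : (Fin d → ℤ_[p]) →+ (Fin n → ℤ_[l]) :=
    { toFun := fun v => Multiplicative.toAdd (f (ι (W.subtype (eW.symm (Multiplicative.ofAdd v)))))
      map_zero' := by simp
      map_add' := fun v w => by
        simp only [ofAdd_add, map_mul, toAdd_mul] }
  have h0 : h = 0 := addMonoidHom_padicInt_module_eq_zero hl h
  have hbound := le_succ_of_denseRange_of_span K f hf W (Fin.elim0 : Fin 0 → (Fin n → ℤ_[l])) ?_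
  · simpa using hbound
  intro w hw
  have hrepr : Multiplicative.toAdd (f (ι w)) = h (Multiplicative.toAdd (eW ⟨w, hw⟩)) := by
    change _ = Multiplicative.toAdd (f (ι (W.subtype (eW.symm (Multiplicative.ofAdd
      (Multiplicative.toAdd (eW ⟨w, hw⟩)))))))
    rw [ofAdd_toAdd, MulEquiv.symm_apply_apply]
    rfl
  rw [hrepr, h0, AddMonoidHom.zero_apply]
  exact Submodule.zero_mem _

end RankBound

end Literature.AnabelianGeometry.AbsoluteAnabelian
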